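import Literature.Barriers.FinalStateConjecture.ExtremalHorizonInstabilityProofs
import Literature.Geometry.Lorentzian.KerrAxialSymmetry
import HarnessLib

/-!
# Barrier catalogue `FinalStateConjecture`: the analytic input of Aretakis's Theorem 3 —
# decay of axisymmetric waves on extremal Kerr (Aretakis 2012)
# (`Literature/Barriers/FinalStateConjecture/`, D-0021, D-0014; family `gr`)

This library states and proves Aretakis's Theorem 3 (ATMP 19 (2015)), clauses `k = 1, 2`, in
universal asymptotic form, for smooth solutions of `□_{g_{M,M}} ψ = 0` near `{r ≥ M} ∩ {t* ≥ 0}` in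
the extremal Kerr–Schild chart with localised data — the conclusion of
`Aretakis2015.scalarInstability_of_facts` (`ExtremalHorizonInstabilityAssembly.lean`) and of
`Aretakis2015.scalarInstability_of_decay` (`ExtremalHorizonBlowupProofs.lean`) — and reduces the
barrier `AretakisInstability` to it (`ExtremalHorizonInstabilityProofs.lean`). The printed proof of
Theorem 3 is one sentence: "Combining the methods of [aretakis2], the results of the present paper
[the conservation laws, Prop. 5.1] and [aretakis3] and by projecting to the zeroth azimuthal
frequency we obtain the following Theorem 3". Of these ingredients the conservation law is proved in
this library (`Aretakis2015_chargeConservation_holds`,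
`ExtremalHorizonChargeConservationProofs.lean`), the projection to the zeroth azimuthal frequency is
proved (`ExtremalHorizonAxisymmetricProjection.lean`) and the `k = 2` blow-up mechanism of Thm. 2
is proved (`ExtremalHorizonBlowupProofs.lean`); the present file vendors the one genuinely analytic
input as a **named fact** (D-0014), for the SAME class of solutions as Theorem 3 restricted to
**axisymmetric** ones:

* `Kerr.IsAxisymmetric ψ` — invariance of `ψ : Kerr.region a r₀ → ℝ` under the axial rotations
  `Kerr.axialRotate a r₀ α` (the flow of the axial Killing field `∂_φ* = x₁∂₂ − x₂∂₁`,
  `Kerr.axialField`; `KerrAxialSymmetry.lean`);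
* `Aretakis2012_pointwiseDecay` — Aretakis, JFA 263 (2012), Thm. 5 (Pointwise decay), second
  clause: `|ψ| ≤ C √(E₃[ψ]) τ^{−1/2}` in `{r ≥ M}` for all axisymmetric solutions from regular data
  (quoted as item 1 of §5.2 of the 2015 paper), in the vendored consequence form
  `sup_{S_τ} |ψ| → 0` along the horizon spheres.

This is the single analytic leaf of the barrier on the extremal side:
`AretakisInstability.of_twoLeaves : KerrSchild.waveCauchyProblem → Aretakis2012_pointwiseDecay →
AretakisInstability` (`ExtremalHorizonInstabilityNarrowLeaves.lean`).

**Review of 2026-08-15 (D-0026/D-0027).** Until that review this file also vendored the `k = 2`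
clause of Thm. 3 for axisymmetric solutions as a second named fact
`Aretakis2015_axisymmetricBlowup`, a slice of the then named fact `Aretakis2015_scalarInstability`;
both had meanwhile been PROVED from `Aretakis2012_pointwiseDecay`
(`Aretakis2015.axisymmetricBlowup_of_decay`, `Aretakis2015.scalarInstability_of_decay`, as they are
named since: the former dotted names counted as uses of the `def`s) and, as
pass-through nodes of the debt census, were merged back into the obligation of the parent
`AretakisInstability`: the two `def`s are gone, their statements are verbatim the conclusions of
those proved conditional theorems, and the tautological
`Aretakis2015_axisymmetricBlowup.of_scalarInstability` (parent implies slice) went with them.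

## Rendering (design)

* *Same class as Theorem 3.* The fact quantifies over `U` open `⊇ {r ≥ r₊ = M} ∩ {t* ≥ 0}` in
  `Kerr.region M r₀` (`0 < r₀ < M`), `ψ` of class `C^∞` on `U` with `□_g ψ = 0` on `U`
  (`Kerr.smoothMetric M M r₀`, `[Kerr.Facts] [Kerr.SliceFacts]` as in gr.S24) and Cauchy data on the
  leaf `{t* = 0}` supported in a coordinate ball (`ψ = 0` and `dψ = 0` at the points of
  `U ∩ {t* = 0}` with `‖x⃗‖ > ρ`) — verbatim the hypotheses of Theorem 3 as vendored
  (`Aretakis2015.scalarInstability_of_facts`) — plus `Kerr.IsAxisymmetric ψ`. As explained in the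
  docstring of that theorem (item (c)), the values and derivatives of such a `ψ` on
  `{r ≥ M} ∩ {t* ≥ 0}` are those of the solution arising from smooth compactly supported data on a
  hypersurface crossing `𝓗⁺`, the class the sources are about; axisymmetry of `ψ` on `U` gives
  axisymmetric data, hence Aretakis's axisymmetric solutions.
* *Foliations.* Aretakis (2012, §2.5; 2015, §2.2) uses `Σ_τ = φ_τ(Σ₀)`, `φ_τ` the flow of
  `T = ∂_v = ∂_{t*}`, and `S_τ = Σ_τ ∩ 𝓗⁺ = φ_τ(S₀)`; with `Σ₀ ∩ 𝓗⁺ = {t* = 0} ∩ {r = M} = S₀`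
  these are exactly the chart sections `Kerr.horizonSection M M r₀ τ` (`Kerr.timeTranslate`), and
  the region `{r ≥ M}` of the 2012 theorem contains `𝓗⁺ = {r = M}`.
* *What is NOT vendored.* The quantitative rate `τ^{−1/2}` and the norm `E₃` (Thm. 5), decay away
  from the horizon, the energy statements (Thms. 1–3 of the 2012 paper), the `k ≥ 3` and energy
  clauses of Thm. 3 (2015). What is NOT here either: any discharge —
  `Aretakis2012_pointwiseDecay_holds` is the sixty-page vector-field decay theory of the 2012 paper
  (§§6–15: Carter separation and microlocal integrated-decay currents, the degenerate redshift, the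
  `P`-hierarchy near `𝓗⁺` and the Dafermos–Rodnianski method), an apex named fact of this
  catalogue.

## References

* S. Aretakis, *Decay of axisymmetric solutions of the wave equation on extreme Kerr backgrounds*,
  J. Funct. Anal. 263 (2012) 2770–2831 (arXiv:1110.2006): §2.4–2.5 (coordinates `(v, r, θ, φ*)`,
  `T = ∂_v`, `Y = ∂_r`, `Φ = ∂_{φ*}`; the foliation `Σ_τ = φ_τ^T(Σ₀)`, the region `𝓡`), §3, Thm. 4
  (Pointwise boundedness) and **Thm. 5 (Pointwise decay)**: "For all axisymmetric solutions `ψ` to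
  the wave equation we have `|ψ| ≤ C √(E₃[ψ]) τ^{−1/2}` in `{r ≥ M}`" (key `Aretakis2012`).
* S. Aretakis, *Horizon instability of extremal black holes*, Adv. Theor. Math. Phys. 19 (2015)
  507–530 (arXiv:1206.6598): §5.2 items 1–2 (quotation of the 2012 results), the sentence before
  Thm. 3, and **Thm. 3** (Scalar instability of extremal Kerr), clause "Pointwise blow-up:
  `sup_{S_τ} |Y^k ψ| ≥ c |H₀[ψ]| τ^{k−1}` asymptotically along `𝓗⁺` for all `k ≥ 2`"; Thm. 2 (the
  general blow-up mechanism) (key `Aretakis2015`).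
* B. O'Neill, *The geometry of Kerr black holes*, 1995, Ch. 2, §2.2 (axial Killing field)
  (key `ONeill1995`).
-/

noncomputable section

open Set Filter
open scoped Manifold ContDiff Topology

namespace Literature.Barriers.FinalStateConjecture.Kerr

open Literature.Geometry.Lorentzian

/-- **Axisymmetry** of a function on the Kerr–Schild chart `Kerr.region a r₀`: invariance under all
axial rotations `R_α` (`Kerr.axialRotate`, the flow of the axial Killing field
`Φ = ∂_{φ*} = x₁∂₂ − x₂∂₁`, `Kerr.axialField`), i.e. `Φψ = 0`. Aretakis, JFA 263 (2012), §1 and §3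
("axisymmetric solutions `ψ` to the wave equation", `Φ = ∂_{φ*}` Killing); O'Neill 1995, Ch. 2, §2.2.
Deliberate dot-notation extension of the prelude namespace `Literature.Geometry.Lorentzian.Kerr`… kept,
like `Kerr.transversalDeriv`, in the barrier namespace `Literature.Barriers.FinalStateConjecture.Kerr`.
[cite: Aretakis2012, §3 (axisymmetric solutions)] -/
def IsAxisymmetric {a r₀ : ℝ} (ψ : Kerr.region a r₀ → ℝ) : Prop :=
  ∀ (α : ℝ) (x : Kerr.region a r₀), ψ (Kerr.axialRotate a r₀ α x) = ψ x

/-- Unfolding lemma. [folklore] -/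
theorem isAxisymmetric_iff {a r₀ : ℝ} (ψ : Kerr.region a r₀ → ℝ) :
    IsAxisymmetric ψ ↔ ∀ (α : ℝ) (x : Kerr.region a r₀), ψ (Kerr.axialRotate a r₀ α x) = ψ x :=
  Iff.rfl

/-- Constant functions are axisymmetric (non-vacuity). [folklore] -/
theorem isAxisymmetric_const {a r₀ : ℝ} (c : ℝ) : IsAxisymmetric (fun _ : Kerr.region a r₀ ↦ c) :=
  fun _ _ ↦ rfl

/-- An axisymmetric function is invariant under `ψ ↦ ψ ∘ R_α`. [folklore] -/
theorem IsAxisymmetric.comp_axialRotate {a r₀ : ℝ} {ψ : Kerr.region a r₀ → ℝ}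
    (h : IsAxisymmetric ψ) (α : ℝ) : ψ ∘ Kerr.axialRotate a r₀ α = ψ :=
  funext fun x ↦ h α x

/-- The horizon sections `S_τ = {r = r₊} ∩ {t* = τ}` are invariant under the axial rotations
(`r` and `t*` are). [folklore] -/
theorem axialRotate_mem_horizonSection_iff {M a r₀ α τ : ℝ} {x : Kerr.region a r₀} :
    Kerr.axialRotate a r₀ α x ∈ horizonSection M a r₀ τ ↔ x ∈ horizonSection M a r₀ τ := by
  simp only [mem_horizonSection, Kerr.coe_axialRotate, Kerr.radius_axialRotation,
    E4.axialRotation_apply_zero]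

end Literature.Barriers.FinalStateConjecture.Kerr

namespace Literature.Barriers.FinalStateConjecture

open Literature.Geometry.Lorentzian

/-! ### The analytic named fact -/

/-- **Pointwise decay of axisymmetric waves along the extremal Kerr horizon (named fact; Aretakis
2012, Thm. 5, in consequence form).** Printed statement (Aretakis, JFA 263 (2012), §3, Thm. 5
(Pointwise Decay), second clause): "Fix `R > M` and let `τ ≥ 1`. There exists a constant `C` that
depends on `M` and `R` such that … • For all axisymmetric solutions `ψ` to the wave equation we have
`|ψ| ≤ C √(E₃[ψ]) τ^{−1/2}` in `{r ≥ M}`", where (§2.5, §3) `Σ_τ = φ_τ^T(Σ₀)` is the foliation by the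
flow of `T = ∂_v`, `τ` its parameter, `Σ₀ = H₀ ∪ Ñ₀` a spacelike-then-null hypersurface crossing
`𝓗⁺` and terminating at null infinity, `𝓡 = J⁺(Σ₀) ∩ (𝓓 ∪ 𝓗⁺)`, the data are prescribed on `Σ₀`
"sufficiently regular such that the right hand side[s] … are all finite", and `E₃[ψ]` is a weighted
third-order initial energy. Quoted in Aretakis, ATMP 19 (2015), §5.2, item 1: "Pointwise decay for
`ψ`: For all axisymmetric solutions `ψ` which arise from regular initial data we have
`‖ψ‖_{L^∞(Σ_τ)} → 0` as `τ → +∞`."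
**Vendored form (a consequence).** For `M > 0`, `0 < r₀ < M`, every open `U ⊇ {r ≥ M} ∩ {t* ≥ 0}`
of the chart `Kerr.region M r₀` of extremal Kerr `g_{M,M}` and every **axisymmetric** `ψ`
(`Kerr.IsAxisymmetric`) of class `C^∞` on `U` with `□_g ψ = 0` on `U` and Cauchy data on `{t* = 0}`
supported in a coordinate ball (as for Theorem 3 as vendored,
`Aretakis2015.scalarInstability_of_facts`; until the review of 2026-08-15 the named fact
`Aretakis2015_scalarInstability`): for every `ε > 0` there is
`τ₁` such that `|ψ(x)| ≤ ε` at every point `x` of every horizon sphere `S_τ = {r = M} ∩ {t* = τ}`,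
`τ ≥ τ₁` (`Kerr.horizonSection`).
**Deviations, all weakenings or identifications.** (a) Only the qualitative consequence
`sup_{S_τ}|ψ| → 0` of the printed rate on the horizon spheres `S_τ ⊆ {r ≥ M} ∩ 𝓡` is vendored
(`S_τ = φ_τ(S₀)`, `S₀ = Σ₀ ∩ 𝓗⁺ = {t* = 0} ∩ {r = M}`; the printed `τ ≥ 1` and the constants are
absorbed in `τ₁`). (b) The class of `ψ`: as for Theorem 3 (module docstring), on
`{r ≥ M} ∩ {t* ≥ 0}` such a `ψ` coincides, with all derivatives, with the solution arising from its
smooth data on `{t* = 0} ∩ {r ≥ M}` (compactly supported, so `E₃ < ∞`, and vanishing near the null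
piece `Ñ₀` of `Σ₀ = ({t* = 0} ∩ {M ≤ r ≤ R}) ∪ Ñ₀` for `R` beyond the support), i.e. with an
"axisymmetric solution which arises from regular initial data" — axisymmetry of `ψ` on `U` giving
axisymmetric data and, by uniqueness, an axisymmetric solution.
[cite: Aretakis2012, Thm. 5 (Pointwise decay, second clause) and §2.5; Aretakis2015, §5.2 item 1] -/
def Aretakis2012_pointwiseDecay : Prop :=
  ∀ [Kerr.Facts] [Kerr.SliceFacts] (M : ℝ), 0 < M → ∀ r₀ ∈ Set.Ioo 0 M,
    ∀ (U : Set (Kerr.region M r₀)) (ψ : Kerr.region M r₀ → ℝ),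
      IsOpen U →
      {x : Kerr.region M r₀ | Kerr.rPlus M M ≤ Kerr.radius M (x : E4) ∧ 0 ≤ (x : E4) 0} ⊆ U →
      ContMDiffOn 𝓘(ℝ, E4) 𝓘(ℝ, ℝ) ∞ ψ U →
      (∀ x ∈ U, (Kerr.smoothMetric M M r₀).toPseudoRiemannianMetric.dalembertian ψ x = 0) →
      (∃ ρ : ℝ, ∀ x ∈ U, (x : E4) 0 = 0 → ρ < E4.spatialNorm (x : E4) →
        ψ x = 0 ∧ mfderiv 𝓘(ℝ, E4) 𝓘(ℝ, ℝ) ψ x = 0) →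
      Kerr.IsAxisymmetric ψ →
      ∀ ε > (0 : ℝ), ∃ τ₁ : ℝ, ∀ τ : ℝ, τ₁ ≤ τ →
        ∀ x ∈ Kerr.horizonSection M M r₀ τ, |ψ x| ≤ ε

end Literature.Barriers.FinalStateConjecture

end
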